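import Literature.MathematicalPhysics.QuantumLattice.XYZGroundStateOrderHolds
import Literature.MathematicalPhysics.QuantumLattice.HeisenbergOrderDLSProofs
import Literature.MathematicalPhysics.QuantumLattice.KroneckerTraceSchwarz
import HarnessLib

/-!
# Björnberg–Ueltschi, Lemma A.1 at positive temperature: `|⟨S²S²⟩_β| ≤ ⟨S¹S¹⟩_β`
# (entrywise positivity of the Gibbs weight of a stoquastic Hamiltonian)

Topic `MathematicalPhysics/QuantumLattice`; the positive-temperature twin of
`XYZGroundStateOrderCorrIneq.lean` (which proves B–U Lemma A.1 for the tracial ground state via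
the positivity of the ground-state projection). No statement of the tree is changed and no named
fact is introduced; everything here is a theorem.

J. E. Björnberg, D. Ueltschi, *Reflection positivity and infrared bounds for quantum spin
systems* (2022) [BjornbergUeltschi2022], **Lemma A.1** (p. 25): "Assume that
`|J²_{x-y}| ≤ J¹_{x-y}` [for all `x, y`]. Then `|⟨S²_0S²_x⟩_{Λ,β,0}| ≤ ⟨S¹_0S¹_x⟩_{Λ,β,0}`." — a
statement about the GIBBS state at `β < ∞`, proved there by the Trotter formula: in the basis where
`S³` is diagonal, `J¹S¹_yS¹_z + J²S²_yS²_z = ¼(J¹-J²)(S⁺S⁺ + S⁻S⁻) + ¼(J¹+J²)(S⁺S⁻ + S⁻S⁺)` (A.3)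
has nonnegative entries, so "the matrix elements of all operators [`e^{-βH}`] are nonnegative",
while the entries of `S²_0S²_x` are dominated by those of `S¹_0S¹_x` (A.4).

## Contents

* **`Matrix.gibbsWeight_apply_nonneg`** — for a matrix `H` with real entries and nonpositive
  off-diagonal entries ("stoquastic") and `β ≥ 0`, every entry of the Gibbs weight `e^{-βH}` is
  real and nonnegative. Proof (Trotter/Euler, as printed): `e^{-βH} = lim_k (1 - βH/k)^k`
  (`Matrix.tendsto_pow_exp_of_norm_sub_le`, the tree's Euler product formula) and `1 - βH/k` is
  entrywise nonnegative for `k ≥ β Σ_a |H_aa|`;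
* `Matrix.abs_re_gibbsState_le_of_apply` — domination of Gibbs expectations by entrywise
  domination: `M ± M'` entrywise nonnegative ⇒ `|Re⟨M'⟩_β| ≤ Re⟨M⟩_β` (B–U (A.4));
* **`xyz₃_abs_gibbsCorr_one_le_zero`** — B–U Lemma A.1 AS PRINTED (`β < ∞`) for the tree's
  three-coupling bond Hamiltonian `H₃(J₁,J₂,J₃) = -Σ_{⟨xy⟩}(J₁b⁰ + J₂b¹ + J₃b²)`
  (`xyzBondHamiltonian₃`): for `|J₂| ≤ J₁`, any `J₃`, `β ≥ 0` and `x ≠ y`,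
  `|Re⟨Sʸ_xSʸ_y⟩_β| ≤ Re⟨Sˣ_xSˣ_y⟩_β`;
* `xyz₃_gibbsState_frame`, `xyz₃_gibbsState_swap`, `gibbsState_anisotropicTorus_three` — the frame
  changes of the tree (cyclic axis permutation, swap of the first two axes, `H(a,b,c) = 2H₃(a,b,c)`)
  for Gibbs states (B–U Prop. 2.4);
* **`xyz_abs_gibbsSpinCorr_one_le_two`, `xyz_abs_gibbsBondCorr_one_le_two`** — (PF₁ᵀ): in the
  rotated frame `H' = anisotropicTorus d L n 1 J₂ J₁` of the tree's assembly, for `|J₂| ≤ J₁`,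
  `β ≥ 0`: `|G¹_β(x,y)| ≤ G²_β(x,y)` (`x ≠ y`) and `|c¹(β)| ≤ c²(β)` — B–U's
  `|⟨S⁽²⁾S⁽²⁾⟩| ≤ ⟨S⁽¹⁾S⁽¹⁾⟩` (their axes `2, 1` are the components `1, 2` here).

WHAT THIS IS NOT: not the orbit inequality `c² ≤ c⁰` nor the polarised-state bound at `β < ∞`
(sequel `XYZThermalLongRangeOrder.lean`); nothing about the Hubbard model.

## References

* [BjornbergUeltschi2022] Lemma A.1 and eqs. (A.3)–(A.4), pp. 25–26; Prop. 2.4; eq. (4.42).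
* [DLS1978] F. J. Dyson, E. H. Lieb, B. Simon, J. Stat. Phys. 18 (1978), §2 (real matrices).
-/

noncomputable section

open Matrix Finset Filter Topology NormedSpace
open scoped ComplexOrder
open Literature.MathematicalPhysics.QuantumLattice Literature.MathematicalPhysics.QuantumLattice.SpinOperators
  Literature.Probability.LatticeModels

/-! ### Linear algebra: entrywise positivity of the Gibbs weight of a stoquastic matrix -/

namespace Matrix

variable {m : Type*} [Fintype m] [DecidableEq m]

omit [DecidableEq m] in
/-- Entrywise-nonnegative complex matrices are closed under multiplication (star order of `ℂ`).
[folklore] -/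
private theorem mul_apply_nonneg_complex {A B : Matrix m m ℂ} (hA : ∀ i j, 0 ≤ A i j) (hB : ∀ i j, 0 ≤ B i j)
    (i j : m) : 0 ≤ (A * B) i j := by
  rw [mul_apply]
  exact sum_nonneg fun k _ => mul_nonneg (hA i k) (hB k j)

/-- Entrywise-nonnegative complex matrices are closed under powers. [folklore] -/
private theorem pow_apply_nonneg_complex {A : Matrix m m ℂ} (hA : ∀ i j, 0 ≤ A i j) (N : ℕ) (i j : m) :
    0 ≤ (A ^ N) i j := by
  induction N generalizing i j with
  | zero =>
    rw [pow_zero, one_apply]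
    split_ifs
    · exact zero_le_one
    · exact le_rfl
  | succ N ih => rw [pow_succ]; exact mul_apply_nonneg_complex ih hA i j

/-- A complex number with vanishing imaginary part is the cast of its real part. [folklore] -/
private theorem eq_ofReal_re_of_im_eq_zero {z : ℂ} (hz : z.im = 0) : z = ((z.re : ℝ) : ℂ) :=
  Complex.ext (by simp) (by simp [hz])

/-- **Entrywise positivity of the Gibbs weight of a stoquastic matrix** (the positivity behind
B–U Lemma A.1: "Then the matrix elements of all operators are nonnegative"): if `H` has real
entries and nonpositive off-diagonal entries, then for every `β ≥ 0` all entries of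
`e^{-βH} = gibbsWeight β H` are real and nonnegative (`0 ≤ ·` in the star order of `ℂ`). Proof by
the Euler/Trotter product formula `e^{-βH} = lim_k (1 - βH/k)^k`
(`Matrix.tendsto_pow_exp_of_norm_sub_le`): for `k ≥ β Σ_a ‖H_aa‖` the matrix `1 - βH/k` is entrywise
nonnegative, hence so are its powers, and the limit of the (real, nonnegative) entries is real and
nonnegative. [cite: BjornbergUeltschi2022, Lemma A.1 (proof)] -/
theorem gibbsWeight_apply_nonneg [Nonempty m] {H : Matrix m m ℂ} (hreal : ∀ i j, (H i j).im = 0)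
    (hoff : ∀ i j, i ≠ j → (H i j).re ≤ 0) {β : ℝ} (hβ : 0 ≤ β) (i j : m) :
    0 ≤ gibbsWeight β H i j := by
  letI : NormedRing (Matrix m m ℂ) := Matrix.linftyOpNormedRing
  letI : NormedAlgebra ℂ (Matrix m m ℂ) := Matrix.linftyOpNormedAlgebra
  haveI : NormOneClass (Matrix m m ℂ) := Matrix.linfty_opNormOneClass
  set X : Matrix m m ℂ := -(β : ℂ) • H with hX
  -- the Euler approximants converge to the Gibbs weight
  have hlim : Tendsto (fun k : ℕ => ((1 : Matrix m m ℂ) + ((k : ℂ))⁻¹ • X) ^ k) atTop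
      (𝓝 (gibbsWeight β H)) := by
    rw [gibbsWeight, ← hX]
    exact tendsto_pow_exp_of_norm_sub_le (𝕂 := ℂ) X (C := 0) (fun k _ => by
      rw [sub_self, norm_zero]; positivity)
  have hentry : Tendsto (fun k : ℕ => (((1 : Matrix m m ℂ) + ((k : ℂ))⁻¹ • X) ^ k) i j) atTop
      (𝓝 (gibbsWeight β H i j)) :=
    ((Matrix.entryLinearMap ℂ ℂ i j).continuous_of_finiteDimensional.tendsto _).comp hlim
  -- the approximants are eventually entrywise nonnegative
  set c : ℝ := ∑ a, ‖H a a‖ with hc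
  have hc0 : 0 ≤ c := sum_nonneg fun a _ => norm_nonneg _
  have hdiag : ∀ a, (H a a).re ≤ c := fun a =>
    ((Complex.re_le_norm _)).trans (single_le_sum (f := fun a => ‖H a a‖) (fun a _ => norm_nonneg _)
      (mem_univ a))
  have hev : ∀ᶠ k : ℕ in atTop, 0 ≤ (((1 : Matrix m m ℂ) + ((k : ℂ))⁻¹ • X) ^ k) i j := by
    filter_upwards [eventually_ge_atTop (⌈β * c⌉₊ + 1)] with k hk
    have hk1 : (⌈β * c⌉₊ : ℝ) + 1 ≤ k := by exact_mod_cast hk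
    have hkβc : β * c ≤ (k : ℝ) - 1 := by linarith [Nat.le_ceil (β * c)]
    have hk0 : (0 : ℝ) < k := by linarith [Nat.le_ceil (β * c), mul_nonneg hβ hc0]
    refine pow_apply_nonneg_complex (fun a b => ?_) k i j
    have hHab : H a b = (((H a b).re : ℝ) : ℂ) := eq_ofReal_re_of_im_eq_zero (hreal a b)
    have hab : ((1 : Matrix m m ℂ) + ((k : ℂ))⁻¹ • X) a b =
        (((if a = b then (1 : ℝ) else 0) + (k : ℝ)⁻¹ * (-β * (H a b).re) : ℝ) : ℂ) := by
      rw [add_apply, smul_apply, hX, smul_apply, smul_eq_mul, smul_eq_mul, one_apply]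
      conv_lhs => rw [hHab]
      split_ifs <;> push_cast <;> ring
    rw [hab]
    refine Complex.zero_le_real.2 ?_
    by_cases h : a = b
    · subst h
      rw [if_pos rfl]
      -- `1 - β re(H_aa)/k ≥ 0` since `β re(H_aa) ≤ βc ≤ k - 1 < k`
      have h1 : β * (H a a).re ≤ (k : ℝ) := by
        have := mul_le_mul_of_nonneg_left (hdiag a) hβ
        linarith
      have h2 : (k : ℝ)⁻¹ * (β * (H a a).re) ≤ 1 := by
        rw [inv_mul_le_iff₀ hk0]; linarith
      nlinarith [h2]
    · rw [if_neg h]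
      have h1 : (H a b).re ≤ 0 := hoff a b h
      have : 0 ≤ (k : ℝ)⁻¹ * (-β * (H a b).re) :=
        mul_nonneg (inv_nonneg.2 hk0.le) (by nlinarith)
      linarith
  -- limits of the real and imaginary parts
  have hre : 0 ≤ (gibbsWeight β H i j).re :=
    ge_of_tendsto ((Complex.continuous_re.tendsto _).comp hentry)
      (hev.mono fun k hk => (Complex.nonneg_iff.mp hk).1)
  have him : (gibbsWeight β H i j).im = 0 := by
    have h1 : Tendsto (fun k : ℕ => ((((1 : Matrix m m ℂ) + ((k : ℂ))⁻¹ • X) ^ k) i j).im) atTop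
        (𝓝 (gibbsWeight β H i j).im) := (Complex.continuous_im.tendsto _).comp hentry
    have h2 : Tendsto (fun k : ℕ => ((((1 : Matrix m m ℂ) + ((k : ℂ))⁻¹ • X) ^ k) i j).im) atTop
        (𝓝 0) :=
      tendsto_const_nhds.congr' (hev.mono fun k hk => (Complex.nonneg_iff.mp hk).2)
    exact tendsto_nhds_unique h1 h2
  exact Complex.nonneg_iff.mpr ⟨hre, him.symm⟩

/-- **Domination of Gibbs expectations by entrywise domination** (B–U (A.4) at `β < ∞`): for a
stoquastic Hermitian `H` (real entries, nonpositive off-diagonal), `β ≥ 0`, and matrices with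
`M ± M'` entrywise nonnegative, `|Re⟨M'⟩_β| ≤ Re⟨M⟩_β` in the Gibbs state of `H`.
[cite: BjornbergUeltschi2022, Lemma A.1 (proof, eq. (A.4))] -/
theorem abs_re_gibbsState_le_of_apply [Nonempty m] {H M M' : Matrix m m ℂ} (hH : H.IsHermitian)
    (hreal : ∀ i j, (H i j).im = 0) (hoff : ∀ i j, i ≠ j → (H i j).re ≤ 0) {β : ℝ} (hβ : 0 ≤ β)
    (hplus : ∀ i j, 0 ≤ (M + M') i j) (hminus : ∀ i j, 0 ≤ (M - M') i j) :
    |(gibbsState β H M').re| ≤ (gibbsState β H M).re := by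
  have hP := gibbsWeight_apply_nonneg hreal hoff hβ
  obtain ⟨hZpos, hZeq⟩ := Matrix.partitionFn_re_pos β hH
  have key : ∀ N : Matrix m m ℂ, (∀ i j, 0 ≤ N i j) → 0 ≤ (gibbsState β H N).re := by
    intro N hN
    rw [gibbsState_apply, hZeq, ← Complex.ofReal_inv, Complex.re_ofReal_mul]
    exact mul_nonneg (inv_nonneg.2 hZpos.le)
      (Complex.nonneg_iff.mp (trace_mul_nonneg_of_apply_nonneg hP hN)).1
  have h1 := key _ hplus
  have h2 := key _ hminus
  rw [map_add, Complex.add_re] at h1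
  rw [map_sub, Complex.sub_re] at h2
  rw [abs_le]
  constructor <;> linarith

end Matrix

namespace Literature.MathematicalPhysics.QuantumLattice

variable {d : ℕ}

/-! ### Lemma A.1 at positive temperature for the three-coupling bond Hamiltonian -/

section LemmaA1

variable (L : ℕ) [NeZero L] (n : ℕ)

/-- **B–U Lemma A.1, as printed (`β < ∞`)**: for `|J₂| ≤ J₁` (any `J₃`), `β ≥ 0` and `x ≠ y`,
`|Re⟨Sʸ_xSʸ_y⟩_β| ≤ Re⟨Sˣ_xSˣ_y⟩_β` in the Gibbs state of `H₃(J₁,J₂,J₃)`: the Gibbs weight has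
nonnegative entries (`H₃` is stoquastic, `xyzBondHamiltonian₃_apply`) and
`Sˣ_xSˣ_y ± Sʸ_xSʸ_y` have nonnegative entries (`½(pq' + qp')δ`, `½(pp' + qq')δ`,
`siteSpin_mul_apply_ladder`). [cite: BjornbergUeltschi2022, Lemma A.1] -/
theorem xyz₃_abs_gibbsCorr_one_le_zero (J₁ J₂ J₃ : ℝ) (hJ : -J₂ ≤ J₁) (hJ' : J₂ ≤ J₁)
    {β : ℝ} (hβ : 0 ≤ β) {x y : TorusSite d L} (hxy : x ≠ y) :
    |(gibbsState β (xyzBondHamiltonian₃ (d := d) L n J₁ J₂ J₃) (siteSpin n x 1 * siteSpin n y 1)).re| ≤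
      (gibbsState β (xyzBondHamiltonian₃ (d := d) L n J₁ J₂ J₃) (siteSpin n x 0 * siteSpin n y 0)).re := by
  haveI : Nonempty (TensorIndex (TorusSite d L) (n + 1)) := ⟨fun _ => 0⟩
  refine Matrix.abs_re_gibbsState_le_of_apply (xyzBondHamiltonian₃_isHermitian L n J₁ J₂ J₃)
    (fun σ τ => (xyzBondHamiltonian₃_apply L n J₁ J₂ J₃ hJ hJ' σ τ).1)
    (fun σ τ hστ => (xyzBondHamiltonian₃_apply L n J₁ J₂ J₃ hJ hJ' σ τ).2 hστ) hβ ?_ ?_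
  · intro σ τ
    obtain ⟨p, q, p', q', δ, hp, hq, hp', hq', hδ, h0, h1⟩ := siteSpin_mul_apply_ladder n hxy σ τ
    rw [Matrix.add_apply, h0, h1, ← Complex.ofReal_add]
    refine Complex.zero_le_real.2 ?_
    have : (p + q) * (p' + q') * δ / 4 + -((p - q) * (p' - q') * δ / 4) = (p * q' + q * p') * δ / 2 := by
      ring
    rw [this]
    positivity
  · intro σ τ
    obtain ⟨p, q, p', q', δ, hp, hq, hp', hq', hδ, h0, h1⟩ := siteSpin_mul_apply_ladder n hxy σ τ
    rw [Matrix.sub_apply, h0, h1, ← Complex.ofReal_sub]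
    refine Complex.zero_le_real.2 ?_
    have : (p + q) * (p' + q') * δ / 4 - -((p - q) * (p' - q') * δ / 4) = (p * p' + q * q') * δ / 2 := by
      ring
    rw [this]
    positivity

end LemmaA1

/-! ### Frame changes for Gibbs states -/

section Frame

variable (L : ℕ) [NeZero L] (n : ℕ) (β : ℝ)

/-- **Covariance of the Gibbs state under a unitary frame change**: if `U K Uᴴ = K'` for a unitary
`U`, then `⟨O⟩_{β,K} = ⟨U O Uᴴ⟩_{β,K'}`. [folklore] -/
private theorem gibbsState_eq_of_conj {U K K' : Op (TorusSite d L) (n + 1)} (hU : U * Uᴴ = 1)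
    (hU' : Uᴴ * U = 1) (hK : U * K * Uᴴ = K') (O : Op (TorusSite d L) (n + 1)) :
    gibbsState β K O = gibbsState β K' (U * O * Uᴴ) := by
  have hK' : Uᴴ * K' * U = K := by
    rw [← hK]
    simp only [← Matrix.mul_assoc]
    rw [hU', Matrix.one_mul, Matrix.mul_assoc, hU', Matrix.mul_one]
  rw [← hK', Matrix.gibbsState_conjTranspose_mul_mul hU hU']

/-- **The correlations in the cyclically rotated frame, at `β < ∞`**: with `⟨·⟩_J` the Gibbs state
of `H₃(J)` at inverse temperature `β`, `⟨Sˣ_xSˣ_y⟩_{(J₁,J₂,J₃)} = ⟨Sᶻ_xSᶻ_y⟩_{(J₂,J₃,J₁)}`,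
`⟨Sʸ_xSʸ_y⟩_{(J₁,J₂,J₃)} = ⟨Sˣ_xSˣ_y⟩_{(J₂,J₃,J₁)}`, `⟨Sᶻ_xSᶻ_y⟩_{(J₁,J₂,J₃)} = ⟨Sʸ_xSʸ_y⟩_{(J₂,J₃,J₁)}`
(the product unitary of `exists_frame_xyzBondHamiltonian₃`).
[cite: BjornbergUeltschi2022, Proposition 2.4] -/
theorem xyz₃_gibbsState_frame (J₁ J₂ J₃ : ℝ) (x y : TorusSite d L) :
    gibbsState β (xyzBondHamiltonian₃ (d := d) L n J₁ J₂ J₃) (siteSpin n x 0 * siteSpin n y 0) =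
      gibbsState β (xyzBondHamiltonian₃ (d := d) L n J₂ J₃ J₁) (siteSpin n x 2 * siteSpin n y 2) ∧
    gibbsState β (xyzBondHamiltonian₃ (d := d) L n J₁ J₂ J₃) (siteSpin n x 1 * siteSpin n y 1) =
      gibbsState β (xyzBondHamiltonian₃ (d := d) L n J₂ J₃ J₁) (siteSpin n x 0 * siteSpin n y 0) ∧
    gibbsState β (xyzBondHamiltonian₃ (d := d) L n J₁ J₂ J₃) (siteSpin n x 2 * siteSpin n y 2) =
      gibbsState β (xyzBondHamiltonian₃ (d := d) L n J₂ J₃ J₁) (siteSpin n x 1 * siteSpin n y 1) := by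
  obtain ⟨U, hU, hU', hH, h0, h1, h2⟩ := exists_frame_xyzBondHamiltonian₃ (d := d) L n J₁ J₂ J₃
  have key : ∀ O : Op (TorusSite d L) (n + 1),
      gibbsState β (xyzBondHamiltonian₃ (d := d) L n J₁ J₂ J₃) O =
        gibbsState β (xyzBondHamiltonian₃ (d := d) L n J₂ J₃ J₁) (U * O * Uᴴ) :=
    fun O => gibbsState_eq_of_conj L n β hU hU' hH O
  have hmul : ∀ A B : Op (TorusSite d L) (n + 1), U * (A * B) * Uᴴ = (U * A * Uᴴ) * (U * B * Uᴴ) := by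
    intro A B
    simp only [mul_assoc]
    rw [← mul_assoc Uᴴ U, hU', one_mul]
  refine ⟨?_, ?_, ?_⟩
  · rw [key, hmul, h0, h0, neg_mul_neg]
  · rw [key, hmul, h1, h1]
  · rw [key, hmul, h2, h2, neg_mul_neg]

/-- **The correlations in the swapped frame, at `β < ∞`**: `⟨Sˣ_xSˣ_y⟩_{(a,b,c)} = ⟨Sʸ_xSʸ_y⟩_{(b,a,c)}`,
`⟨Sʸ_xSʸ_y⟩_{(a,b,c)} = ⟨Sˣ_xSˣ_y⟩_{(b,a,c)}`, `⟨Sᶻ_xSᶻ_y⟩_{(a,b,c)} = ⟨Sᶻ_xSᶻ_y⟩_{(b,a,c)}` (the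
product unitary of `exists_swap_xyzBondHamiltonian₃`). [cite: BjornbergUeltschi2022, Proposition 2.4] -/
theorem xyz₃_gibbsState_swap (a b c : ℝ) (x y : TorusSite d L) :
    gibbsState β (xyzBondHamiltonian₃ (d := d) L n a b c) (siteSpin n x 0 * siteSpin n y 0) =
      gibbsState β (xyzBondHamiltonian₃ (d := d) L n b a c) (siteSpin n x 1 * siteSpin n y 1) ∧
    gibbsState β (xyzBondHamiltonian₃ (d := d) L n a b c) (siteSpin n x 1 * siteSpin n y 1) =
      gibbsState β (xyzBondHamiltonian₃ (d := d) L n b a c) (siteSpin n x 0 * siteSpin n y 0) ∧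
    gibbsState β (xyzBondHamiltonian₃ (d := d) L n a b c) (siteSpin n x 2 * siteSpin n y 2) =
      gibbsState β (xyzBondHamiltonian₃ (d := d) L n b a c) (siteSpin n x 2 * siteSpin n y 2) := by
  obtain ⟨U, hU, hU', hH, h0, h1, h2⟩ := exists_swap_xyzBondHamiltonian₃ (d := d) L n a b c
  have key : ∀ O : Op (TorusSite d L) (n + 1),
      gibbsState β (xyzBondHamiltonian₃ (d := d) L n a b c) O =
        gibbsState β (xyzBondHamiltonian₃ (d := d) L n b a c) (U * O * Uᴴ) :=
    fun O => gibbsState_eq_of_conj L n β hU hU' hH O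
  have hmul : ∀ A B : Op (TorusSite d L) (n + 1), U * (A * B) * Uᴴ = (U * A * Uᴴ) * (U * B * Uᴴ) := by
    intro A B
    simp only [mul_assoc]
    rw [← mul_assoc Uᴴ U, hU', one_mul]
  refine ⟨?_, ?_, ?_⟩
  · rw [key, hmul, h0, h0, neg_mul_neg]
  · rw [key, hmul, h1, h1]
  · rw [key, hmul, h2, h2]

/-- **Same Gibbs states up to the temperature scale**: `⟨·⟩_{β, H(a,b,c)} = ⟨·⟩_{2β, H₃(a,b,c)}`
(`H(a,b,c) = 2H₃(a,b,c)`, `anisotropicTorus_eq_two_smul_three`). [cite: BjornbergUeltschi2022, §2 (2.4)] -/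
theorem gibbsState_anisotropicTorus_three (a b c : ℝ) (A : Op (TorusSite d L) (n + 1)) :
    gibbsState β (anisotropicTorus d L n a b c) A = gibbsState (β * 2) (xyzBondHamiltonian₃ L n a b c) A := by
  rw [anisotropicTorus_eq_two_smul_three, show (2 : ℂ) = ((2 : ℝ) : ℂ) by norm_num,
    Matrix.gibbsState_ofReal_smul]

end Frame

/-! ### (PF₁ᵀ) The correlation inequality in the rotated frame `H' = H(1, J₂, J₁)` -/

section PF

variable (L : ℕ) [NeZero L] (n : ℕ) (J₁ J₂ : ℝ)

/-- **B–U Lemma A.1 (`β < ∞`) in the rotated frame, pointwise**: for `|J₂| ≤ J₁`, `β ≥ 0` and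
`x ≠ y`, `|G¹_β(x,y)| ≤ G²_β(x,y)` for the thermal correlations of `H' = H(1, J₂, J₁)` (B–U:
`|⟨S⁽²⁾_xS⁽²⁾_y⟩_β| ≤ ⟨S⁽¹⁾_xS⁽¹⁾_y⟩_β`; their axes `2, 1` are the components `1, 2` here). Via
`⟨·⟩_{β,H(1,J₂,J₁)} = ⟨·⟩_{2β,H₃(1,J₂,J₁)}`, the cyclic frame (`H₃(1,J₂,J₁) ↦ H₃(J₂,J₁,1)`), the swap
frame (`↦ H₃(J₁,J₂,1)`) and Lemma A.1 for `H₃(J₁,J₂,1)`. [cite: BjornbergUeltschi2022, Lemma A.1] -/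
theorem xyz_abs_gibbsSpinCorr_one_le_two {β : ℝ} (hβ : 0 ≤ β) (hJ : -J₂ ≤ J₁) (hJ' : J₂ ≤ J₁)
    {x y : TorusSite d L} (hxy : x ≠ y) :
    |gibbsSpinCorr β (anisotropicTorus d L n 1 J₂ J₁) 1 x y| ≤
      gibbsSpinCorr β (anisotropicTorus d L n 1 J₂ J₁) 2 x y := by
  rw [gibbsSpinCorr, gibbsSpinCorr, gibbsState_anisotropicTorus_three, gibbsState_anisotropicTorus_three]
  obtain ⟨-, ha1, ha2⟩ := xyz₃_gibbsState_frame (d := d) L n (β * 2) 1 J₂ J₁ x y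
  obtain ⟨hb0, hb1, -⟩ := xyz₃_gibbsState_swap (d := d) L n (β * 2) J₂ J₁ 1 x y
  rw [ha1, ha2, hb0, hb1]
  exact xyz₃_abs_gibbsCorr_one_le_zero L n J₁ J₂ 1 hJ hJ' (by positivity) hxy

/-- **(PF₁ᵀ) averaged**: `|c¹(β)| ≤ c²(β)` on tori of side `L ≥ 2` for `|J₂| ≤ J₁`, `β ≥ 0`
(`x ≠ x + eᵢ`). [cite: BjornbergUeltschi2022, Lemma A.1] -/
theorem xyz_abs_gibbsBondCorr_one_le_two (hL : 2 ≤ L) {β : ℝ} (hβ : 0 ≤ β) (hJ : -J₂ ≤ J₁)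
    (hJ' : J₂ ≤ J₁) :
    |gibbsBondCorr β (anisotropicTorus d L n 1 J₂ J₁) 1| ≤
      gibbsBondCorr β (anisotropicTorus d L n 1 J₂ J₁) 2 := by
  have hne : ∀ (x : TorusSite d L) (i : Fin d), x ≠ x + Pi.single i 1 := fun x i h =>
    single_ne_zero_of_two_le L hL i (by simpa using h.symm)
  have hden : 0 ≤ (d : ℝ) * (L : ℝ) ^ d := by positivity
  rw [gibbsBondCorr, gibbsBondCorr, abs_div, abs_of_nonneg hden]
  refine div_le_div_of_nonneg_right ?_ hden
  refine (abs_sum_le_sum_abs _ _).trans (sum_le_sum fun x _ => ?_)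
  refine (abs_sum_le_sum_abs _ _).trans (sum_le_sum fun i _ => ?_)
  exact xyz_abs_gibbsSpinCorr_one_le_two L n J₁ J₂ hβ hJ hJ' (hne x i)

end PF

end Literature.MathematicalPhysics.QuantumLattice

end
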